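import Literature.Geometry.Kaehler.ManifoldFormsPullback
import Literature.Geometry.Kaehler.ManifoldFormsChart
import Literature.Analysis.Calculus.PullbackVariation
import HarnessLib

/-!
# Pull-backs along families of maps: chart formulas and the variation formula

Topic: differential forms on manifolds (companion of `ManifoldFormsPullback.lean`). Theorems only.

`ManifoldFormsPullback.lean` expresses the chart representative of a pull-back `f^*β` in the
chart at `x₀` through the representative of `β` in the chart **at `f x₀`**
(`MForm.inChart_pullback_eq`). For *families* of maps `f = Ψ_p` one needs the same formula with a
*fixed* chart of the target containing the relevant points, independently of `p`; this file
provides it, together with the analogous formula for the contraction `Ψ^*(ι_V β)` of `β` with a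
vector field `V` along the map (the shape of the two terms of the variation formula
`∂_p Ψ_p^*β = Ψ^*(ι_{∂_pΨ} dβ) + d Ψ^*(ι_{∂_pΨ} β)`), and the expression of the variation
vector `∂_p Ψ_p(x)` in the target chart.

* `mfderiv_comp_mfderivWithin_extChartAt_symm_eq` — the chain rule behind everything: for `y` in
  the target of the chart at `x₀` with `f (chart⁻¹ y)` in the source of the chart at `z₀`,
  `df ∘ D(chart_{x₀}⁻¹)(y) = D(chart_{z₀}⁻¹)(g y) ∘ Dg(y)`, `g = chart_{z₀} ∘ f ∘ chart_{x₀}⁻¹`.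
* `MForm.inChart_pullback_eq_of_mem_source` — `(f^*β)̂_{x₀}(y) = β̂_{z₀}(g y) ∘ Dg(y)`.
* `MForm.inChart_contractionAlong_eq_of_mem_source` — the same for
  `x ↦ (β (f x))(V x, df ·, …, df ·)`: its representative is `(β̂_{z₀}(g y))(D chart_{z₀}(V), Dg(y) ·, …)`.
* `mfderiv_extChartAt_apply_mfderiv_eq_fderiv` — for a family `Φ : P → N` from a normed space,
  `D chart_{z₀} (dΦ_t h) = D(chart_{z₀} ∘ Φ)(t) h`.
* `contDiffAt_inChart_pullback_family` — for a jointly smooth family `Ψ : P → M → N` and a smooth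
  form `β`, `(p, y) ↦ ((Ψ p)^*β)̂_{x₀}(y)` is `C^∞`.
* `smoothAt_contraction_family` — the contraction `Ψ_t^*(ι_{Y_h} β)` with the variation field
  `Y_h = ∂_p Ψ(·, x')(t) h` is a smooth form.
* `hasFDerivAt_pullback_family` — **the variation formula**
  `∂_h (Ψ_p^*β)(x)|_{p = t} = d(Ψ_t^*(ι_{Y_h} β))(x) + Ψ_t^*(ι_{Y_h} dβ)(x)` (Cartan's formula along
  a map; Lee (2013), Thm. 14.35, proof of Lemma 17.9), from the flat
  `Literature.Analysis.Calculus.fderiv_pullback_family` in the charts at `x` and `Ψ t x`.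

Warner (1983), 2.22–2.23; Lee (2013), Lemma 14.16 (pull-backs in coordinates), Thm. 14.35
(Cartan's formula; held text `book:lee2012-introduction-smooth-manifolds`, p. 372), Lemma 17.9
(p. 442). No new facts.

## References

* F. W. Warner, *Foundations of Differentiable Manifolds and Lie Groups*, GTM 94 (1983), 2.22.
  [WarnerGTM94]
* J. M. Lee, *Introduction to Smooth Manifolds*, 2nd ed. (2013), Lemma 14.16, Thm. 14.35,
  Lemma 17.9. [LeeSmoothManifolds2013]
-/

noncomputable section

open scoped Manifold ContDiff Topology
open Bundle Set Function Filter

namespace Literature.Geometry.Kaehler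

-- The identification `TangentSpace I x = E` is an abuse of definitional equality (see
-- `NormedSpace.fromTangentSpace`); as in Mathlib's tangent-bundle files we let `isDefEq` unfold it.
set_option backward.isDefEq.respectTransparency false

variable {E : Type*} [NormedAddCommGroup E] [NormedSpace ℝ E]
  {H : Type*} [TopologicalSpace H] {I : ModelWithCorners ℝ E H}
  {M : Type*} [TopologicalSpace M] [ChartedSpace H M]
  {E' : Type*} [NormedAddCommGroup E'] [NormedSpace ℝ E']
  {H' : Type*} [TopologicalSpace H'] {I' : ModelWithCorners ℝ E' H'}
  {N : Type*} [TopologicalSpace N] [ChartedSpace H' N]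
  {F : Type*} [NormedAddCommGroup F] [NormedSpace ℝ F] {k : ℕ}

section Chart

variable [IsManifold I ∞ M] [IsManifold I' ∞ N]

/-- **The chain rule behind the chart formulas, arbitrary target chart.** Let `y` be a point of
the target of the chart at `x₀`, `z = (extChartAt I x₀).symm y`, with `f` differentiable at `z`
and `f z` in the source of the chart at `z₀`; write `g = extChartAt I' z₀ ∘ f ∘ (extChartAt I x₀).symm`.
Then `df_z ∘ D(extChartAt I x₀).symm(y) = D(extChartAt I' z₀).symm(g y) ∘ Dg(y)` (both are the
derivative within `range I` of `f ∘ (extChartAt I x₀).symm = (extChartAt I' z₀).symm ∘ g` at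
`y`). Warner (1983), 2.22; Lee (2013), Lemma 14.16. [cite: WarnerGTM94, 2.22] -/
theorem mfderiv_comp_mfderivWithin_extChartAt_symm_eq {f : M → N} {x₀ : M} (z₀ : N) {y : E}
    (hy : y ∈ (extChartAt I x₀).target)
    (hfs : f ((extChartAt I x₀).symm y) ∈ (extChartAt I' z₀).source)
    (hf : MDifferentiableAt I I' f ((extChartAt I x₀).symm y)) :
    (mfderiv I I' f ((extChartAt I x₀).symm y)).comp
        (mfderivWithin 𝓘(ℝ, E) I (extChartAt I x₀).symm (range I) y) =
      (mfderivWithin 𝓘(ℝ, E') I' (extChartAt I' z₀).symm (range I')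
          (extChartAt I' z₀ (f ((extChartAt I x₀).symm y)))).comp
        (fderivWithin ℝ (extChartAt I' z₀ ∘ f ∘ (extChartAt I x₀).symm) (range I) y) := by
  set z := (extChartAt I x₀).symm y with hz
  set g : E → E' := extChartAt I' z₀ ∘ f ∘ (extChartAt I x₀).symm with hg
  have hyI : y ∈ range I := extChartAt_target_subset_range x₀ hy
  have hU : UniqueMDiffWithinAt 𝓘(ℝ, E) (range I) y := (I.uniqueDiffOn y hyI).uniqueMDiffWithinAt
  have hgt : g y ∈ (extChartAt I' z₀).target := (extChartAt I' z₀).map_source hfs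
  have hfz : (extChartAt I' z₀).symm (g y) = f z := (extChartAt I' z₀).left_inv hfs
  have hmaps : range I ⊆ g ⁻¹' range I' := fun w _ ↦ by
    simp only [hg, mem_preimage, Function.comp_apply, extChartAt_coe]
    exact mem_range_self _
  -- (1) `D(f ∘ chart⁻¹)(y) = df_z ∘ D(chart⁻¹)(y)`
  have h1 : mfderivWithin 𝓘(ℝ, E) I' (f ∘ (extChartAt I x₀).symm) (range I) y =
      (mfderiv I I' f z).comp (mfderivWithin 𝓘(ℝ, E) I (extChartAt I x₀).symm (range I) y) :=
    mfderiv_comp_mfderivWithin y hf (mdifferentiableWithinAt_extChartAt_symm hy) hU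
  -- (2) `f ∘ chart⁻¹ = chart'⁻¹ ∘ g` near `y` within `range I`
  have h2 : (f ∘ (extChartAt I x₀).symm) =ᶠ[𝓝[range I] y] ((extChartAt I' z₀).symm ∘ g) := by
    have hc : ContinuousAt (f ∘ (extChartAt I x₀).symm) y :=
      ContinuousAt.comp (by rw [← hz]; exact hf.continuousAt) (continuousAt_extChartAt_symm'' hy)
    have h3 : ∀ᶠ w in 𝓝 y, f ((extChartAt I x₀).symm w) ∈ (extChartAt I' z₀).source :=
      hc.preimage_mem_nhds (extChartAt_source_mem_nhds' hfs)
    filter_upwards [nhdsWithin_le_nhds h3] with w hw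
    simp only [Function.comp_apply, hg, (extChartAt I' z₀).left_inv hw]
  have h3 : mfderivWithin 𝓘(ℝ, E) I' (f ∘ (extChartAt I x₀).symm) (range I) y =
      mfderivWithin 𝓘(ℝ, E) I' ((extChartAt I' z₀).symm ∘ g) (range I) y :=
    h2.mfderivWithin_eq (by simp only [Function.comp_apply, hfz, hz])
  -- (3) `D(chart'⁻¹ ∘ g)(y) = D(chart'⁻¹)(g y) ∘ Dg(y)`
  have hgd : MDifferentiableWithinAt 𝓘(ℝ, E) 𝓘(ℝ, E') g (range I) y :=
    (mdifferentiableAt_extChartAt (by rw [← extChartAt_source I']; exact hfs)).comp_mdifferentiableWithinAt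
      y (hf.comp_mdifferentiableWithinAt y (mdifferentiableWithinAt_extChartAt_symm hy))
  have h4 : mfderivWithin 𝓘(ℝ, E) I' ((extChartAt I' z₀).symm ∘ g) (range I) y =
      (mfderivWithin 𝓘(ℝ, E') I' (extChartAt I' z₀).symm (range I') (g y)).comp
        (mfderivWithin 𝓘(ℝ, E) 𝓘(ℝ, E') g (range I) y) :=
    mfderivWithin_comp y (mdifferentiableWithinAt_extChartAt_symm hgt) hgd hmaps hU
  have h5 : mfderivWithin 𝓘(ℝ, E) 𝓘(ℝ, E') g (range I) y = fderivWithin ℝ g (range I) y :=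
    mfderivWithin_eq_fderivWithin
  rw [← h1, h3, h4, h5]
  rfl

/-- **The pull-back in an arbitrary chart of the target.** In the situation of
`mfderiv_comp_mfderivWithin_extChartAt_symm_eq`, the representative of `f^*β` in the chart at `x₀`
is, at `y`, the pull-back of the representative of `β` in the chart at `z₀` along
`g = extChartAt I' z₀ ∘ f ∘ (extChartAt I x₀).symm`:
`(f^*β).inChart x₀ y = (β.inChart z₀ (g y)) ∘ Dg(y)` (`MForm.inChart_pullback_eq` is the case
`z₀ = f x₀`). Warner (1983), 2.22; Lee (2013), Lemma 14.16. [cite: WarnerGTM94, 2.22] -/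
theorem MForm.inChart_pullback_eq_of_mem_source {f : M → N} (β : MForm I' N F k) {x₀ : M}
    (z₀ : N) {y : E} (hy : y ∈ (extChartAt I x₀).target)
    (hfs : f ((extChartAt I x₀).symm y) ∈ (extChartAt I' z₀).source)
    (hf : MDifferentiableAt I I' f ((extChartAt I x₀).symm y)) :
    (β.pullback I f).inChart x₀ y =
      (β.inChart z₀ (extChartAt I' z₀ (f ((extChartAt I x₀).symm y)))).compContinuousLinearMap
        (fderivWithin ℝ (extChartAt I' z₀ ∘ f ∘ (extChartAt I x₀).symm) (range I) y) := by
  have key := mfderiv_comp_mfderivWithin_extChartAt_symm_eq z₀ hy hfs hf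
  have hfz : (extChartAt I' z₀).symm (extChartAt I' z₀ (f ((extChartAt I x₀).symm y))) =
      f ((extChartAt I x₀).symm y) := (extChartAt I' z₀).left_inv hfs
  ext v
  simp only [MForm.inChart_apply, MForm.pullback_apply,
    ContinuousAlternatingMap.compContinuousLinearMap_apply, Function.comp_apply]
  rw [hfz]
  congr 1
  funext i
  exact ContinuousLinearMap.ext_iff.1 key (v i)

/-- **The contraction along a map in an arbitrary chart of the target.** For a `(k+1)`-form `β` on
`N`, a map `f : M → N` and a vector field `V` along `f` (`V x ∈ T_{f x} N = E'`), consider the `k`-form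
`x ↦ f^*(ι_V β) := (β (f x))(V x, df ·, …, df ·)` on `M` (the value `β (f x)` read in the model
space `E'`, where Mathlib's `curryLeft` lives). In the situation of
`mfderiv_comp_mfderivWithin_extChartAt_symm_eq` its representative in the chart at `x₀` is, at `y`,
`(β.inChart z₀ (g y))(D(extChartAt I' z₀)(V z), Dg(y) ·, …, Dg(y) ·)` with
`z = (extChartAt I x₀).symm y` (chain rule as above, plus
`D(extChartAt I' z₀).symm ∘ D(extChartAt I' z₀) = id` at `f z`). [cite: WarnerGTM94, 2.22] -/
theorem MForm.inChart_contractionAlong_eq_of_mem_source {f : M → N} (β : MForm I' N F (k + 1))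
    (V : M → E') {x₀ : M} (z₀ : N) {y : E} (hy : y ∈ (extChartAt I x₀).target)
    (hfs : f ((extChartAt I x₀).symm y) ∈ (extChartAt I' z₀).source)
    (hf : MDifferentiableAt I I' f ((extChartAt I x₀).symm y)) :
    MForm.inChart (I := I) (M := M)
        (fun x ↦ letI b : E' [⋀^Fin (k + 1)]→L[ℝ] F := β (f x)
          (b.curryLeft (V x)).compContinuousLinearMap (mfderiv I I' f x)) x₀ y =
      ((β.inChart z₀ (extChartAt I' z₀ (f ((extChartAt I x₀).symm y)))).curryLeft
          (mfderiv I' 𝓘(ℝ, E') (extChartAt I' z₀) (f ((extChartAt I x₀).symm y))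
            (V ((extChartAt I x₀).symm y)))).compContinuousLinearMap
        (fderivWithin ℝ (extChartAt I' z₀ ∘ f ∘ (extChartAt I x₀).symm) (range I) y) := by
  have key := mfderiv_comp_mfderivWithin_extChartAt_symm_eq z₀ hy hfs hf
  have hfz : (extChartAt I' z₀).symm (extChartAt I' z₀ (f ((extChartAt I x₀).symm y))) =
      f ((extChartAt I x₀).symm y) := (extChartAt I' z₀).left_inv hfs
  have hinv := mfderivWithin_extChartAt_symm_comp_mfderiv_extChartAt' (I := I') hfs
  ext v
  simp only [MForm.inChart_apply, ContinuousAlternatingMap.compContinuousLinearMap_apply,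
    ContinuousAlternatingMap.curryLeft_apply_apply]
  rw [hfz]
  congr 1
  funext j
  refine Fin.cases ?_ (fun i ↦ ?_) j
  · simp only [Matrix.cons_val_zero]
    exact (ContinuousLinearMap.ext_iff.1 hinv (V ((extChartAt I x₀).symm y))).symm
  · simp only [Matrix.cons_val_succ]
    exact ContinuousLinearMap.ext_iff.1 key (v i)

omit [IsManifold I ∞ M] in
/-- **The variation vector in the target chart.** For a family `Φ : P → N` parametrised by a
normed space, differentiable at `t` with `Φ t` in the source of the chart at `z₀`, the image of
the variation vector `dΦ_t h ∈ T_{Φ t} N` under the derivative of the chart is the ordinary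
derivative of the chart expression: `D(extChartAt I' z₀)(dΦ_t h) = D(extChartAt I' z₀ ∘ Φ)(t) h`.
[folklore] -/
theorem mfderiv_extChartAt_apply_mfderiv_eq_fderiv {P : Type*} [NormedAddCommGroup P]
    [NormedSpace ℝ P] {Φ : P → N} {t : P} (z₀ : N) (hΦs : Φ t ∈ (extChartAt I' z₀).source)
    (hΦ : MDifferentiableAt 𝓘(ℝ, P) I' Φ t) (h : P) :
    mfderiv I' 𝓘(ℝ, E') (extChartAt I' z₀) (Φ t) (mfderiv 𝓘(ℝ, P) I' Φ t h) =
      fderiv ℝ (extChartAt I' z₀ ∘ Φ) t h := by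
  have he : MDifferentiableAt I' 𝓘(ℝ, E') (extChartAt I' z₀) (Φ t) :=
    mdifferentiableAt_extChartAt (by rw [← extChartAt_source I']; exact hΦs)
  rw [← mfderiv_eq_fderiv, mfderiv_comp t he hΦ]
  rfl

end Chart

/-! ### Flat model computations -/

section Flat

variable {EP EM ET : Type*} [NormedAddCommGroup EP] [NormedSpace ℝ EP] [NormedAddCommGroup EM]
  [NormedSpace ℝ EM] [NormedAddCommGroup ET] [NormedSpace ℝ ET]

/-- **Smoothness of the model contraction.** For a `C^∞` family `ψ : EP × EM → ET` near `(t, y)`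
and a `C^∞` family of `(k+1)`-forms `ξ` near `ψ (t, y)`, the `k`-form
`y' ↦ (ξ (ψ (t, y')))(∂_t ψ(·, y') h, ∂_y ψ(t, ·) ·, …)` is `C^∞` at `y` (composition of `C^∞`
maps with the bounded bilinear currying and the polynomial pull-back). [folklore] -/
theorem contDiffAt_contraction_model {ψ : EP × EM → ET} {ξ : ET → ET [⋀^Fin (k + 1)]→L[ℝ] F}
    {t : EP} {y : EM} (h : EP) (hψ : ContDiffAt ℝ ∞ ψ (t, y))
    (hξ : ContDiffAt ℝ ∞ ξ (ψ (t, y))) :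
    ContDiffAt ℝ ∞ (fun y' ↦ ((ξ (ψ (t, y'))).curryLeft
        (fderiv ℝ (fun t' ↦ ψ (t', y')) t h)).compContinuousLinearMap
      (fderiv ℝ (fun y'' ↦ ψ (t, y'')) y')) y := by
  -- the curve `y' ↦ (t, y')` and smoothness of the pieces along it
  have hc : ContDiffAt ℝ ∞ (fun y' : EM ↦ (t, y')) y := contDiffAt_const.prodMk contDiffAt_id
  have hψt : ContDiffAt ℝ ∞ (fun y' ↦ ψ (t, y')) y := hψ.comp y hc
  have hA : ContDiffAt ℝ ∞ (fun y' ↦ ξ (ψ (t, y'))) y := hξ.comp y hψt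
  have hD : ContDiffAt ℝ ∞ (fun y' ↦ fderiv ℝ ψ (t, y')) y :=
    (hψ.fderiv_right (m := ∞) (by simp)).comp y hc
  -- the currying as a bounded bilinear map
  set L₂ : (ET [⋀^Fin (k + 1)]→L[ℝ] F) →L[ℝ] ET →L[ℝ] (ET [⋀^Fin k]→L[ℝ] F) :=
    (ContinuousAlternatingMap.curryLeftLI (𝕜 := ℝ) (E := ET) (F := F) (n := k)).toContinuousLinearMap
    with hL₂
  have hL₂a : ∀ (a : ET [⋀^Fin (k + 1)]→L[ℝ] F) (w : ET), L₂ a w = a.curryLeft w := fun _ _ ↦ rfl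
  have hW : ContDiffAt ℝ ∞ (fun y' ↦ fderiv ℝ ψ (t, y') (h, 0)) y := hD.clm_apply contDiffAt_const
  have hcurry : ContDiffAt ℝ ∞ (fun y' ↦ L₂ (ξ (ψ (t, y'))) (fderiv ℝ ψ (t, y') (h, 0))) y :=
    (L₂.isBoundedBilinearMap.contDiff.contDiffAt).comp y (hA.prodMk hW)
  have hrhs : ContDiffAt ℝ ∞ (fun y' ↦ (L₂ (ξ (ψ (t, y'))) (fderiv ℝ ψ (t, y') (h, 0)))
      |>.compContinuousLinearMap ((fderiv ℝ ψ (t, y')).comp (ContinuousLinearMap.inr ℝ EP EM))) y :=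
    Literature.NumberTheory.Transcendental.ContDiffAt.continuousAlternatingMapCompContinuousLinearMap
      hcurry (hD.clm_comp contDiffAt_const)
  -- near `y` the two spellings agree (partial derivatives through the total derivative)
  have hev : ∀ᶠ y' in 𝓝 y, DifferentiableAt ℝ ψ (t, y') := by
    have h1 : ∀ᶠ z in 𝓝 (t, y), ContDiffAt ℝ 1 ψ z := (hψ.of_le (by simp)).eventually (by simp)
    exact (hc.continuousAt.tendsto.eventually h1).mono fun y' hy' ↦ hy'.differentiableAt one_ne_zero
  refine hrhs.congr_of_eventuallyEq ?_
  filter_upwards [hev] with y' hy'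
  rw [hL₂a, Literature.Analysis.Calculus.fderiv_curry_left_apply_eq hy' h,
    Literature.Analysis.Calculus.fderiv_curry_right_eq hy']

end Flat

/-! ### Families of maps: the representative in `P × (chart)` -/

section Family

variable [IsManifold I ∞ M] [IsManifold I' ∞ N]
  {P : Type*} [NormedAddCommGroup P] [NormedSpace ℝ P]

omit [IsManifold I ∞ M] in
/-- Inverse of the extended chart of `P × M` at `(p₀, x₀)` for a normed space `P`:
`id × (extChartAt I x₀)⁻¹`. [folklore] -/
theorem extChartAt_vectorSpace_prod_symm_apply (p₀ : P) (x₀ : M) (q : P × E) :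
    (extChartAt (𝓘(ℝ, P).prod I) (p₀, x₀)).symm q = (q.1, (extChartAt I x₀).symm q.2) := by
  rw [extChartAt_prod, PartialEquiv.prod_symm]
  simp

omit [IsManifold I ∞ M] in
/-- The extended chart of `P × M` at `(p₀, x₀)` for a normed space `P`: `id × extChartAt I x₀`.
[folklore] -/
theorem extChartAt_vectorSpace_prod_apply (p₀ : P) (x₀ : M) (q : P × M) :
    extChartAt (𝓘(ℝ, P).prod I) (p₀, x₀) q = (q.1, extChartAt I x₀ q.2) := by
  rw [extChartAt_prod]
  simp

/-- **A jointly smooth family read in fixed charts is smooth.** If `(p, x) ↦ Ψ p x` is `C^∞` at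
`(q.1, (extChartAt I x₀).symm q.2)` (as a map `P × M → N`) and takes there a value in the source
of the chart at `z₀`, then `(p, y) ↦ extChartAt I' z₀ (Ψ p ((extChartAt I x₀).symm y))` is `C^∞`
at `q` (boundaryless `M`; this is `contMDiffAt_iff_of_mem_source` for the product chart
`id × extChartAt I x₀` and the chart at `z₀`). [folklore] -/
theorem contDiffAt_extChartAt_family [I.Boundaryless] {Ψ : P → M → N} {x₀ : M} (z₀ : N)
    {q : P × E} (hq : q.2 ∈ (extChartAt I x₀).target)
    (hz : Ψ q.1 ((extChartAt I x₀).symm q.2) ∈ (extChartAt I' z₀).source)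
    (hΨ : ContMDiffAt (𝓘(ℝ, P).prod I) I' ∞ (uncurry Ψ) (q.1, (extChartAt I x₀).symm q.2)) :
    ContDiffAt ℝ ∞ (fun q' : P × E ↦ extChartAt I' z₀ (Ψ q'.1 ((extChartAt I x₀).symm q'.2))) q := by
  have hxs : (extChartAt I x₀).symm q.2 ∈ (chartAt H x₀).source := by
    rw [← extChartAt_source I]; exact (extChartAt I x₀).map_target hq
  have hx : (q.1, (extChartAt I x₀).symm q.2) ∈ (chartAt (ModelProd P H) (q.1, x₀)).source := by
    rw [prodChartedSpace_chartAt]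
    simpa using hxs
  have hy : uncurry Ψ (q.1, (extChartAt I x₀).symm q.2) ∈ (chartAt H' z₀).source := by
    rw [← extChartAt_source I']; exact hz
  have h := ((contMDiffAt_iff_of_mem_source hx hy).1 hΨ).2
  rw [extChartAt_vectorSpace_prod_apply, (extChartAt I x₀).right_inv hq,
    ModelWithCorners.Boundaryless.range_eq_univ, contDiffWithinAt_univ] at h
  have hfun : (extChartAt I' z₀ ∘ uncurry Ψ ∘ (extChartAt (𝓘(ℝ, P).prod I) (q.1, x₀)).symm) =
      fun q' : P × E ↦ extChartAt I' z₀ (Ψ q'.1 ((extChartAt I x₀).symm q'.2)) := by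
    funext q'
    simp only [Function.comp_apply, extChartAt_vectorSpace_prod_symm_apply, uncurry_apply_pair]
  rwa [hfun] at h

/-- **The chart representative of a smooth family of pull-backs is jointly smooth.** Let
`(p, x) ↦ Ψ p x` be `C^∞` near `(q.1, (extChartAt I x₀).symm q.2)` and `β` a smooth form on `N`
(both manifolds boundaryless). Then `(p, y) ↦ ((Ψ p)^*β).inChart x₀ y` is `C^∞` at `q`: near `q`
it is the pull-back of the `C^∞` germ `β.inChart z₀`, `z₀ = Ψ q.1 ((extChartAt I x₀).symm q.2)`,
along the `C^∞` family `ψ (p, y) = extChartAt I' z₀ (Ψ p ((extChartAt I x₀).symm y))`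
(`MForm.inChart_pullback_eq_of_mem_source`), i.e. `(β.inChart z₀ (ψ q')) ∘ (Dψ(q') ∘ inr)`.
Warner (1983), 2.22; Lee (2013), Lemma 14.16. [cite: WarnerGTM94, 2.22] -/
theorem contDiffAt_inChart_pullback_family [I.Boundaryless] [I'.Boundaryless] {Ψ : P → M → N}
    {β : MForm I' N F k} (hβ : IsSmoothForm β) {x₀ : M} {q : P × E}
    (hq : q.2 ∈ (extChartAt I x₀).target)
    (hΨ : ∀ᶠ q' in 𝓝 (q.1, (extChartAt I x₀).symm q.2),
      ContMDiffAt (𝓘(ℝ, P).prod I) I' ∞ (uncurry Ψ) q') :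
    ContDiffAt ℝ ∞ (fun q' : P × E ↦ (β.pullback I (Ψ q'.1)).inChart x₀ q'.2) q := by
  set z₀ : N := Ψ q.1 ((extChartAt I x₀).symm q.2) with hz₀
  set ψ : P × E → E' := fun q' ↦ extChartAt I' z₀ (Ψ q'.1 ((extChartAt I x₀).symm q'.2))
    with hψ
  -- transport the hypotheses to `𝓝 q` in `P × E`
  have hcont : ContinuousAt (fun q' : P × E ↦ (q'.1, (extChartAt I x₀).symm q'.2)) q :=
    continuousAt_fst.prodMk ((continuousAt_extChartAt_symm'' hq).comp continuousAt_snd)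
  have hΨq : ContMDiffAt (𝓘(ℝ, P).prod I) I' ∞ (uncurry Ψ) (q.1, (extChartAt I x₀).symm q.2) :=
    hΨ.self_of_nhds
  have h1 : ∀ᶠ q' in 𝓝 q, ContMDiffAt (𝓘(ℝ, P).prod I) I' ∞ (uncurry Ψ)
      (q'.1, (extChartAt I x₀).symm q'.2) := hcont.tendsto.eventually hΨ
  have h2 : ∀ᶠ q' in 𝓝 q, q'.2 ∈ (extChartAt I x₀).target :=
    continuousAt_snd.preimage_mem_nhds ((isOpen_extChartAt_target x₀).mem_nhds hq)
  have h3 : ∀ᶠ q' in 𝓝 q, Ψ q'.1 ((extChartAt I x₀).symm q'.2) ∈ (extChartAt I' z₀).source := by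
    have hc : ContinuousAt (uncurry Ψ ∘ fun q' : P × E ↦ (q'.1, (extChartAt I x₀).symm q'.2)) q :=
      ContinuousAt.comp_of_eq hΨq.continuousAt hcont rfl
    exact hc.preimage_mem_nhds (extChartAt_source_mem_nhds (I := I') z₀)
  -- `ψ` is smooth near `q`
  have hψs : ∀ᶠ q' in 𝓝 q, ContDiffAt ℝ ∞ ψ q' := by
    filter_upwards [h1, h2, h3] with q' h1' h2' h3'
    exact contDiffAt_extChartAt_family z₀ h2' h3' h1'
  have hψq : ContDiffAt ℝ ∞ ψ q := hψs.self_of_nhds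
  -- the formula near `q`
  have hformula : (fun q' : P × E ↦ (β.pullback I (Ψ q'.1)).inChart x₀ q'.2) =ᶠ[𝓝 q]
      fun q' ↦ (β.inChart z₀ (ψ q')).compContinuousLinearMap
        ((fderiv ℝ ψ q').comp (ContinuousLinearMap.inr ℝ P E)) := by
    filter_upwards [h1, h2, h3, hψs] with q' h1' h2' h3' h4'
    obtain ⟨p', y'⟩ := q'
    have hmd : MDifferentiableAt I I' (Ψ p') ((extChartAt I x₀).symm y') := by
      have hc : ContMDiffAt I I' ∞ (Ψ p') ((extChartAt I x₀).symm y') :=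
        h1'.comp ((extChartAt I x₀).symm y') (contMDiffAt_const.prodMk contMDiffAt_id)
      exact hc.mdifferentiableAt (by simp)
    rw [β.inChart_pullback_eq_of_mem_source z₀ h2' h3' hmd,
      ModelWithCorners.Boundaryless.range_eq_univ, fderivWithin_univ]
    congr 1
    exact Literature.Analysis.Calculus.fderiv_curry_right_eq (h4'.differentiableAt (by simp))
  -- smoothness of the right-hand side
  have hrhs : ContDiffAt ℝ ∞ (fun q' ↦ (β.inChart z₀ (ψ q')).compContinuousLinearMap
      ((fderiv ℝ ψ q').comp (ContinuousLinearMap.inr ℝ P E))) q := by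
    refine Literature.NumberTheory.Transcendental.ContDiffAt.continuousAlternatingMapCompContinuousLinearMap
      ?_ ?_
    · have hβ' : ContDiffAt ℝ ∞ (β.inChart z₀) (ψ q) := by
        have h := hβ z₀
        rw [ModelWithCorners.Boundaryless.range_eq_univ, contDiffWithinAt_univ] at h
        exact h
      exact hβ'.comp q hψq
    · exact (hψq.fderiv_right (m := ∞) (by simp)).clm_comp contDiffAt_const
  exact hrhs.congr_of_eventuallyEq hformula

omit [IsManifold I ∞ M] [IsManifold I' ∞ N] in
/-- The two slices of a jointly smooth family are differentiable. [folklore] -/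
theorem mdifferentiableAt_slices_of_contMDiffAt {Ψ : P → M → N} {p : P} {x : M}
    (h : ContMDiffAt (𝓘(ℝ, P).prod I) I' ∞ (uncurry Ψ) (p, x)) :
    MDifferentiableAt I I' (Ψ p) x ∧ MDifferentiableAt 𝓘(ℝ, P) I' (fun p' ↦ Ψ p' x) p :=
  ⟨(h.comp x (contMDiffAt_const.prodMk contMDiffAt_id)).mdifferentiableAt (by simp),
    (h.comp p (contMDiffAt_id.prodMk contMDiffAt_const)).mdifferentiableAt (by simp)⟩

/-- Bookkeeping for families read in the charts at `x₀` and at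
`z₀ = Ψ q.1 ((extChartAt I x₀).symm q.2)`: near `q` in `P × E` the family is smooth at the
corresponding point of `P × M`, the chart point lies in the target, the value lies in the source
of the chart at `z₀`, and the chart expression `ψ` is `C^∞`. [folklore] -/
theorem eventually_nhds_family_chart [I.Boundaryless] {Ψ : P → M → N} {x₀ : M} {q : P × E}
    (hq : q.2 ∈ (extChartAt I x₀).target)
    (hΨ : ∀ᶠ q' in 𝓝 (q.1, (extChartAt I x₀).symm q.2),
      ContMDiffAt (𝓘(ℝ, P).prod I) I' ∞ (uncurry Ψ) q') :
    ∀ᶠ q' in 𝓝 q,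
      ContMDiffAt (𝓘(ℝ, P).prod I) I' ∞ (uncurry Ψ) (q'.1, (extChartAt I x₀).symm q'.2) ∧
      q'.2 ∈ (extChartAt I x₀).target ∧
      Ψ q'.1 ((extChartAt I x₀).symm q'.2) ∈
        (extChartAt I' (Ψ q.1 ((extChartAt I x₀).symm q.2))).source ∧
      ContDiffAt ℝ ∞ (fun q'' : P × E ↦ extChartAt I' (Ψ q.1 ((extChartAt I x₀).symm q.2))
        (Ψ q''.1 ((extChartAt I x₀).symm q''.2))) q' := by
  set z₀ : N := Ψ q.1 ((extChartAt I x₀).symm q.2) with hz₀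
  have hcont : ContinuousAt (fun q' : P × E ↦ (q'.1, (extChartAt I x₀).symm q'.2)) q :=
    continuousAt_fst.prodMk ((continuousAt_extChartAt_symm'' hq).comp continuousAt_snd)
  have hΨq : ContMDiffAt (𝓘(ℝ, P).prod I) I' ∞ (uncurry Ψ) (q.1, (extChartAt I x₀).symm q.2) :=
    hΨ.self_of_nhds
  have h1 : ∀ᶠ q' in 𝓝 q, ContMDiffAt (𝓘(ℝ, P).prod I) I' ∞ (uncurry Ψ)
      (q'.1, (extChartAt I x₀).symm q'.2) := hcont.tendsto.eventually hΨ
  have h2 : ∀ᶠ q' in 𝓝 q, q'.2 ∈ (extChartAt I x₀).target :=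
    continuousAt_snd.preimage_mem_nhds ((isOpen_extChartAt_target x₀).mem_nhds hq)
  have h3 : ∀ᶠ q' in 𝓝 q, Ψ q'.1 ((extChartAt I x₀).symm q'.2) ∈ (extChartAt I' z₀).source := by
    have hc : ContinuousAt (uncurry Ψ ∘ fun q' : P × E ↦ (q'.1, (extChartAt I x₀).symm q'.2)) q :=
      ContinuousAt.comp_of_eq hΨq.continuousAt hcont rfl
    exact hc.preimage_mem_nhds (extChartAt_source_mem_nhds (I := I') z₀)
  have h123 := (h1.and h2).and h3
  filter_upwards [h1, h2, h3, eventually_eventually_nhds.2 h123] with q' h1' h2' h3' h4'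
  refine ⟨h1', h2', h3', ?_⟩
  have h4 : ∀ᶠ q'' in 𝓝 q', ContDiffAt ℝ ∞ (fun q'' : P × E ↦ extChartAt I' z₀
      (Ψ q''.1 ((extChartAt I x₀).symm q''.2))) q'' := by
    filter_upwards [h4'] with q'' hq''
    exact contDiffAt_extChartAt_family z₀ hq''.1.2 hq''.2 hq''.1.1
  exact h4.self_of_nhds

/-- **The contraction form of a family in the charts, near a point** (the common germ computation
behind `smoothAt_contraction_family` and `hasFDerivAt_pullback_family`). With `y = extChartAt I x x`,
`z₀ = Ψ t ((extChartAt I x).symm y)` and `ψ (p, y') = extChartAt I' z₀ (Ψ p ((extChartAt I x).symm y'))`,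
near `y` the representative in the chart at `x` of
`x' ↦ (β (Ψ t x'))(∂_p Ψ(·, x')(t) h, dΨ_t ·, …)` is
`y' ↦ ((β.inChart z₀ (ψ (t, y'))) (∂_p ψ(·, y')(t) h, ·)) ∘ D(ψ (t, ·))(y')`. [cite: WarnerGTM94, 2.22] -/
theorem inChart_contraction_family_eventuallyEq [I.Boundaryless] [I'.Boundaryless]
    {Ψ : P → M → N} (β : MForm I' N F (k + 1)) {t : P} {x : M} (h : P)
    (hΨ : ∀ᶠ q in 𝓝 (t, (extChartAt I x).symm (extChartAt I x x)),
      ContMDiffAt (𝓘(ℝ, P).prod I) I' ∞ (uncurry Ψ) q) :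
    MForm.inChart (I := I) (M := M)
        (fun x' ↦ letI b : E' [⋀^Fin (k + 1)]→L[ℝ] F := β (Ψ t x')
          (b.curryLeft (mfderiv 𝓘(ℝ, P) I' (fun p ↦ Ψ p x') t h)).compContinuousLinearMap
            (mfderiv I I' (Ψ t) x')) x =ᶠ[𝓝 (extChartAt I x x)]
      fun y' ↦ ((β.inChart (Ψ t ((extChartAt I x).symm (extChartAt I x x)))
          (extChartAt I' (Ψ t ((extChartAt I x).symm (extChartAt I x x)))
            (Ψ t ((extChartAt I x).symm y')))).curryLeft
          (fderiv ℝ (fun p ↦ extChartAt I' (Ψ t ((extChartAt I x).symm (extChartAt I x x)))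
            (Ψ p ((extChartAt I x).symm y'))) t h)).compContinuousLinearMap
        (fderiv ℝ (fun y'' ↦ extChartAt I' (Ψ t ((extChartAt I x).symm (extChartAt I x x)))
            (Ψ t ((extChartAt I x).symm y''))) y') := by
  set y : E := extChartAt I x x with hy
  set z₀ : N := Ψ t ((extChartAt I x).symm y) with hz₀
  have hyt : y ∈ (extChartAt I x).target := mem_extChartAt_target x
  have hev := eventually_nhds_family_chart (I := I) (I' := I') (Ψ := Ψ) (x₀ := x) (q := (t, y))
    hyt hΨ
  have hsl : Tendsto (fun y' : E ↦ (t, y')) (𝓝 y) (𝓝 (t, y)) :=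
    (continuous_const.prodMk continuous_id).tendsto' y (t, y) rfl
  filter_upwards [hsl.eventually hev] with y' hy'
  obtain ⟨h1', h2', h3', -⟩ := hy'
  obtain ⟨hmd, hmdP⟩ := mdifferentiableAt_slices_of_contMDiffAt h1'
  rw [MForm.inChart_contractionAlong_eq_of_mem_source β _ z₀ h2' h3' hmd,
    ModelWithCorners.Boundaryless.range_eq_univ, fderivWithin_univ,
    mfderiv_extChartAt_apply_mfderiv_eq_fderiv (Φ := fun p ↦ Ψ p ((extChartAt I x).symm y'))
      z₀ h3' hmdP h]
  rfl

/-- **The contraction form of a smooth family with the variation field is smooth.** For a jointly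
smooth family `Ψ` near `{t} × {x}` and a smooth `(k+1)`-form `β` on `N`, the `k`-form
`x' ↦ Ψ_t^*(ι_{∂_pΨ h} β)(x') = (β (Ψ t x'))(dΨ(·, x')_t h, dΨ_t ·, …, dΨ_t ·)` is smooth at `x`
(its chart representative is the `C^∞` expression of `inChart_contraction_family_eventuallyEq`).
[cite: WarnerGTM94, 2.22] -/
theorem smoothAt_contraction_family [I.Boundaryless] [I'.Boundaryless] {Ψ : P → M → N}
    {β : MForm I' N F (k + 1)} (hβ : IsSmoothForm β) {t : P} {x : M} (h : P)
    (hΨ : ∀ᶠ q in 𝓝 (t, x), ContMDiffAt (𝓘(ℝ, P).prod I) I' ∞ (uncurry Ψ) q) :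
    MForm.SmoothAt (I := I) (M := M)
      (fun x' ↦ letI b : E' [⋀^Fin (k + 1)]→L[ℝ] F := β (Ψ t x')
        (b.curryLeft (mfderiv 𝓘(ℝ, P) I' (fun p ↦ Ψ p x') t h)).compContinuousLinearMap
          (mfderiv I I' (Ψ t) x')) x := by
  set y : E := extChartAt I x x with hy
  have hxy : (extChartAt I x).symm y = x := extChartAt_to_inv x
  have hyt : y ∈ (extChartAt I x).target := mem_extChartAt_target x
  have hΨ' : ∀ᶠ q in 𝓝 (t, (extChartAt I x).symm y),
      ContMDiffAt (𝓘(ℝ, P).prod I) I' ∞ (uncurry Ψ) q := by rwa [hxy]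
  have hev := eventually_nhds_family_chart (I := I) (I' := I') (Ψ := Ψ) (x₀ := x) (q := (t, y))
    hyt hΨ'
  obtain ⟨-, -, -, hψq⟩ := hev.self_of_nhds
  have hformula := inChart_contraction_family_eventuallyEq (I := I) (I' := I') β h hΨ'
  have hβ' : ContDiffAt ℝ ∞ (β.inChart (Ψ t ((extChartAt I x).symm y)))
      (extChartAt I' (Ψ t ((extChartAt I x).symm y)) (Ψ t ((extChartAt I x).symm y))) := by
    have h0 := hβ (Ψ t ((extChartAt I x).symm y))
    rw [ModelWithCorners.Boundaryless.range_eq_univ, contDiffWithinAt_univ] at h0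
    exact h0
  change ContDiffWithinAt ℝ ∞ _ (range I) y
  rw [ModelWithCorners.Boundaryless.range_eq_univ, contDiffWithinAt_univ]
  exact (contDiffAt_contraction_model h hψq hβ').congr_of_eventuallyEq hformula

/-- **The variation formula for pull-backs along a family of maps** (manifold version of
`Literature.Analysis.Calculus.fderiv_pullback_family`). Let `(p, x') ↦ Ψ p x'` be jointly smooth
near `(t, x)` (`M`, `N` boundaryless) and `β` a smooth `(k+1)`-form on `N`. Then
`p ↦ (Ψ_p^*β)(x)` (a curve in the fixed fibre `Λ^{k+1} T_x^*M ⊗ F`) is differentiable at `t`, with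
derivative in the direction `h`
`∂_h (Ψ_p^*β)(x) = d(Ψ_t^*(ι_{Y_h} β))(x) + Ψ_t^*(ι_{Y_h} dβ)(x)`,
where `Y_h(x') = dΨ(·, x')_t h ∈ T_{Ψ t x'} N` is the variation field along `Ψ_t` and
`Ψ_t^*(ι_Y γ)(x') = (γ (Ψ t x'))(Y x', dΨ_t ·, …, dΨ_t ·)` (Cartan's formula along a map: for
`Ψ_p` the flow of a vector field this is `L_V ω = V ⌟ dω + d(V ⌟ ω)`, Lee (2013), Thm. 14.35,
and for `Ψ_t = i_t : M → M × ℝ` it is the computation `d/dt i_t^*ω = i_t^*(S ⌟ dω) + d i_t^*(S ⌟ ω)`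
in the proof of Lee (2013), Lemma 17.9). In the charts at `x` and `Ψ t x` this is the flat
statement `Literature.Analysis.Calculus.fderiv_pullback_family`.
[cite: LeeSmoothManifolds2013, Thm. 14.35 and proof of Lemma 17.9] -/
theorem hasFDerivAt_pullback_family [I.Boundaryless] [I'.Boundaryless] {Ψ : P → M → N}
    {β : MForm I' N F (k + 1)} (hβ : IsSmoothForm β) {t : P} {x : M}
    (hΨ : ∀ᶠ q in 𝓝 (t, x), ContMDiffAt (𝓘(ℝ, P).prod I) I' ∞ (uncurry Ψ) q) :
    ∃ L : P →L[ℝ] (E [⋀^Fin (k + 1)]→L[ℝ] F),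
      HasFDerivAt (fun p ↦ (β.pullback I (Ψ p) x : E [⋀^Fin (k + 1)]→L[ℝ] F)) L t ∧
      ∀ h, L h =
        (mextDeriv (I := I) (M := M)
            (fun x' ↦ letI b : E' [⋀^Fin (k + 1)]→L[ℝ] F := β (Ψ t x')
              (b.curryLeft (mfderiv 𝓘(ℝ, P) I' (fun p ↦ Ψ p x') t h)).compContinuousLinearMap
                (mfderiv I I' (Ψ t) x')) x : E [⋀^Fin (k + 1)]→L[ℝ] F) +
        (letI b : E' [⋀^Fin (k + 1 + 1)]→L[ℝ] F := mextDeriv β (Ψ t x);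
          (b.curryLeft (mfderiv 𝓘(ℝ, P) I' (fun p ↦ Ψ p x) t h)).compContinuousLinearMap
            (mfderiv I I' (Ψ t) x)) := by
  set y : E := extChartAt I x x with hy
  have hxy : (extChartAt I x).symm y = x := extChartAt_to_inv x
  have hyt : y ∈ (extChartAt I x).target := mem_extChartAt_target x
  have hΨ' : ∀ᶠ q in 𝓝 (t, (extChartAt I x).symm y),
      ContMDiffAt (𝓘(ℝ, P).prod I) I' ∞ (uncurry Ψ) q := by rwa [hxy]
  have hev := eventually_nhds_family_chart (I := I) (I' := I') (Ψ := Ψ) (x₀ := x) (q := (t, y))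
    hyt hΨ'
  obtain ⟨hΨq, -, hZs, hψq⟩ := hev.self_of_nhds
  dsimp only at hΨq hZs hψq hev
  obtain ⟨hmd, hmdP⟩ := mdifferentiableAt_slices_of_contMDiffAt hΨq
  -- abbreviations: the target chart centre, the family and the form read in the charts
  set Z : N := Ψ t ((extChartAt I x).symm y) with hZ
  set ψ : P × E → E' := fun q' ↦ extChartAt I' Z (Ψ q'.1 ((extChartAt I x).symm q'.2)) with hψ
  set ξ : E' → E' [⋀^Fin (k + 1)]→L[ℝ] F := β.inChart Z with hξ
  have hβ' : ContDiffAt ℝ ∞ ξ (ψ (t, y)) := by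
    have h0 := hβ Z
    rw [ModelWithCorners.Boundaryless.range_eq_univ, contDiffWithinAt_univ] at h0
    exact h0
  have hψ2 : ContDiffAt ℝ 2 ψ (t, y) := hψq.of_le (WithTop.coe_le_coe.2 le_top)
  have hξd : DifferentiableAt ℝ ξ (ψ (t, y)) := hβ'.differentiableAt (by simp)
  -- (a) the curve in the fibre is the chart representative at the centre
  have hG : (fun p ↦ (β.pullback I (Ψ p) x : E [⋀^Fin (k + 1)]→L[ℝ] F)) =
      fun p ↦ (β.pullback I (Ψ p)).inChart x y :=
    funext fun p ↦ ((β.pullback I (Ψ p)).inChart_apply_self x).symm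
  -- (b) near `t` the representative is the model pull-back family
  have hsl : Tendsto (fun p : P ↦ (p, y)) (𝓝 t) (𝓝 (t, y)) :=
    (continuous_id.prodMk continuous_const).tendsto' t (t, y) rfl
  have hGev : (fun p ↦ (β.pullback I (Ψ p)).inChart x y) =ᶠ[𝓝 t]
      fun p ↦ (ξ (ψ (p, y))).compContinuousLinearMap (fderiv ℝ (fun y' ↦ ψ (p, y')) y) := by
    filter_upwards [hsl.eventually hev] with p hp
    obtain ⟨h1', h2', h3', -⟩ := hp
    obtain ⟨hmd', -⟩ := mdifferentiableAt_slices_of_contMDiffAt h1'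
    rw [β.inChart_pullback_eq_of_mem_source Z h2' h3' hmd',
      ModelWithCorners.Boundaryless.range_eq_univ, fderivWithin_univ]
    rfl
  -- (c) the flat variation formula
  have hflat := fun h ↦ Literature.Analysis.Calculus.fderiv_pullback_family (k := k) hψ2 hξd h
  refine ⟨fderiv ℝ (fun p ↦ (β.pullback I (Ψ p)).inChart x y) t, ?_, fun h ↦ ?_⟩
  · rw [hG]
    exact ((hflat 0).1.congr_of_eventuallyEq hGev).hasFDerivAt
  rw [hGev.fderiv_eq, (hflat h).2]
  congr 1
  · -- (e) the exact term is `d(Ψ_t^*(ι_Y β))(x)`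
    have hη : MForm.SmoothAt (I := I) (M := M)
        (fun x' ↦ letI b : E' [⋀^Fin (k + 1)]→L[ℝ] F := β (Ψ t x')
          (b.curryLeft (mfderiv 𝓘(ℝ, P) I' (fun p ↦ Ψ p x') t h)).compContinuousLinearMap
            (mfderiv I I' (Ψ t) x')) ((extChartAt I x).symm y) := by
      rw [hxy]; exact smoothAt_contraction_family hβ h hΨ
    have hC := inChart_contraction_family_eventuallyEq (I := I) (I' := I') β h hΨ'
    rw [← MForm.inChart_apply_self (I := I) (mextDeriv _) x, inChart_mextDeriv_of_mem_target _ hyt hη,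
      ModelWithCorners.Boundaryless.range_eq_univ, extDerivWithin_univ, hC.extDeriv_eq]
  · -- (d) the second term is `Ψ_t^*(ι_Y dβ)(x)`
    have hw : extChartAt I' Z (Ψ t ((extChartAt I x).symm y)) ∈ (extChartAt I' Z).target :=
      (extChartAt I' Z).map_source hZs
    have hβs : β.SmoothAt ((extChartAt I' Z).symm (extChartAt I' Z (Ψ t ((extChartAt I x).symm y)))) :=
      hβ _
    have key := MForm.inChart_contractionAlong_eq_of_mem_source (I := I) (I' := I') (mextDeriv β)
      (fun x' ↦ mfderiv 𝓘(ℝ, P) I' (fun p ↦ Ψ p x') t h) Z hyt hZs hmd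
    rw [inChart_mextDeriv_of_mem_target β hw hβs,
      ModelWithCorners.Boundaryless.range_eq_univ (I := I'),
      ModelWithCorners.Boundaryless.range_eq_univ (I := I), extDerivWithin_univ, fderivWithin_univ,
      mfderiv_extChartAt_apply_mfderiv_eq_fderiv (Φ := fun p ↦ Ψ p ((extChartAt I x).symm y))
        Z hZs hmdP h] at key
    have hself := MForm.inChart_apply_self (I := I)
      (fun x' ↦ letI b : E' [⋀^Fin (k + 1 + 1)]→L[ℝ] F := mextDeriv β (Ψ t x');
        (b.curryLeft (mfderiv 𝓘(ℝ, P) I' (fun p ↦ Ψ p x') t h)).compContinuousLinearMap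
          (mfderiv I I' (Ψ t) x')) x
    exact (hself.symm.trans key).symm

end Family

end Literature.Geometry.Kaehler
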